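import Summits.AtomisticToContinuum.Crystallization.Theorems.CrystalliteDichotomyCutPasteLaw
import Summits.AtomisticToContinuum.Crystallization.Theorems.ChargedEnergyGap.Negative.Unconditional
import Summits.AtomisticToContinuum.Crystallization.Theorems.PricedLinkCensusChargedPeriodicIsOptimalPacking

/-!
# Route `FrustratedLawDichotomy`, crux `TexturedLawTransfer` (stmt-AtomisticToContinuum-27625):
registered stub `stub_windowEnergyCeiling` of the skeleton line «truncated-bs»

**Window energy ceiling.**  For every `η > 0` there are a shell width `L`, a shell fraction `ε` and a size
threshold `n₀` such that for every finite Lennard-Jones ground state `w`, every centre `wᵢ` and every radius `r`,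
if the ball cluster `B = {j : |w_j − w_i| ≤ r}` has `#B ≥ n₀` particles and its outer shell
`{j : r − L < |w_j − w_i| ≤ r}` holds at most `ε · #B` of them, then the internal double sum
`Σ_{j,k ∈ B} V_LJ(|w_k − w_j|)` is at most `(e_per + η) · 2#B`, where `e_per = ⨅_Q e_LJ(Q)` is the periodic
infimum (= `lim E(N)/N`, `ChargedEnergyGapNegative.crysEnergyLimit`).

Proof (cut and paste + tails, no new idea):
* `CrystalliteDichotomyCutPasteLaw.pairSum_add_two_mul_cross_le_groundStateEnergy`:
  `Σ_{B×B} V + 2·Σ_{B×Bᶜ} V ≤ 2 E(#B)` for a ground state [cite: BlancLewin2015, §1.2];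
* the cross term is almost non-negative: `V_LJ(t) ≥ −t⁻⁶/6` (`neg_le_lennardJones_of_le`), ground states are
  `δ = 1/3`-separated (`LennardJonesMinimalDistance_holds`), a DEEP site (`|w_a − w_i| ≤ r − L`) sees `Bᶜ` only at
  distance `≥ L`, so its inverse-sixth-power sum is `≤ 250 δ⁻⁵ L⁻¹` (`ChargedPeriodicOptimal.sum_inv_pow_six_far_le`),
  and a SHELL site contributes at most `250 δ⁻⁶` (`sum_inv_pow_six_le`); there are `≤ ε #B` shell sites;
* `E(n) ≤ (e_per + η/2)·n` for `n ≥ n₀` (`crysEnergyLimit`).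
Choosing `L` with `(250/6) δ⁻⁵ L⁻¹ ≤ η/4` and `ε` with `(250/6) δ⁻⁶ ε = η/4` gives the claim.
-/

namespace Summit.AtomisticToContinuum.Crystallization.Theorems.FrustratedLawDichotomyWindowEnergyCeiling

open Literature.MathematicalPhysics.StatisticalMechanics

variable {N : ℕ}

/-- **Cross inverse-sixth-power sum, deep/shell split.**  In a `δ`-separated configuration, for index sets `B`
(inside the closed `r`-ball about `wᵢ`) and `C` (outside it), `Σ_{a∈B} Σ_{b∈C} |w_a − w_b|⁻⁶ ≤ 250 δ⁻⁵ L⁻¹ · #B +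
250 δ⁻⁶ · #S`, where `S` contains every site of `B` in the shell `r − L < |w_a − w_i|`: deep sites see `C` only
beyond distance `L`. [folklore] -/
theorem cross_inv_pow_six_le (w : Fin N → EuclideanSpace ℝ (Fin 3)) {δ : ℝ} (hδ : 0 < δ)
    (hsep : ∀ k l, k ≠ l → δ ≤ dist (w k) (w l)) (i : Fin N) (r L : ℝ) (hL : 0 < L)
    (B C S : Finset (Fin N))
    (hB : ∀ a ∈ B, dist (w a) (w i) ≤ r) (hC : ∀ b ∈ C, r < dist (w b) (w i))
    (hS : ∀ a ∈ B, r - L < dist (w a) (w i) → a ∈ S) :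
    ∑ a ∈ B, ∑ b ∈ C, (dist (w a) (w b))⁻¹ ^ 6 ≤
      250 * δ⁻¹ ^ 5 * L⁻¹ * B.card + 250 * δ⁻¹ ^ 6 * S.card := by
  have hCne : ∀ a ∈ B, ∀ b ∈ C, b ≠ a := fun a ha b hb hba => by
    have h1 := hC b hb
    rw [hba] at h1
    exact absurd (hB a ha) (not_le.2 h1)
  have hshell : ∀ a ∈ B, ∑ b ∈ C, (dist (w a) (w b))⁻¹ ^ 6 ≤ 250 * δ⁻¹ ^ 6 := fun a ha =>
    le_trans (Finset.sum_le_sum_of_subset_of_nonneg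
      (fun b hb => Finset.mem_erase.2 ⟨hCne a ha b hb, Finset.mem_univ b⟩)
      (fun b _ _ => by positivity)) (sum_inv_pow_six_le w hδ hsep a)
  have hdeep : ∀ a ∈ B, dist (w a) (w i) ≤ r - L →
      ∑ b ∈ C, (dist (w a) (w b))⁻¹ ^ 6 ≤ 250 * δ⁻¹ ^ 5 * L⁻¹ := fun a ha hd =>
    le_trans (Finset.sum_le_sum_of_subset_of_nonneg
      (fun b hb => Finset.mem_filter.2 ⟨Finset.mem_erase.2 ⟨hCne a ha b hb, Finset.mem_univ b⟩, by
        have h1 := hC b hb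
        have h2 := dist_triangle (w b) (w a) (w i)
        rw [dist_comm (w b) (w a)] at h2
        linarith⟩)
      (fun b _ _ => by positivity)) (ChargedPeriodicOptimal.sum_inv_pow_six_far_le w hδ hsep a hL)
  rw [← Finset.sum_filter_add_sum_filter_not B (fun a => dist (w a) (w i) ≤ r - L)]
  have h1 : ∑ a ∈ B.filter (fun a => dist (w a) (w i) ≤ r - L), ∑ b ∈ C, (dist (w a) (w b))⁻¹ ^ 6 ≤
      250 * δ⁻¹ ^ 5 * L⁻¹ * B.card := by
    refine le_trans (Finset.sum_le_sum fun a ha =>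
      hdeep a (Finset.mem_filter.1 ha).1 (Finset.mem_filter.1 ha).2) ?_
    rw [Finset.sum_const, nsmul_eq_mul, mul_comm]
    exact mul_le_mul_of_nonneg_left (by exact_mod_cast Finset.card_filter_le _ _) (by positivity)
  have h2 : ∑ a ∈ B.filter (fun a => ¬ dist (w a) (w i) ≤ r - L), ∑ b ∈ C, (dist (w a) (w b))⁻¹ ^ 6 ≤
      250 * δ⁻¹ ^ 6 * S.card := by
    refine le_trans (Finset.sum_le_sum fun a ha => hshell a (Finset.mem_filter.1 ha).1) ?_
    rw [Finset.sum_const, nsmul_eq_mul, mul_comm]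
    refine mul_le_mul_of_nonneg_left ?_ (by positivity)
    exact_mod_cast Finset.card_le_card fun a ha =>
      hS a (Finset.mem_filter.1 ha).1 (not_le.1 (Finset.mem_filter.1 ha).2)
  linarith

/-- **Cross Lennard-Jones floor.**  `Σ_{a∈B} Σ_{b∈C} V_LJ(|w_a − w_b|) ≥ −(1/6) Σ_{a∈B} Σ_{b∈C} |w_a − w_b|⁻⁶` when
`C` avoids `B` pointwise (so all distances are positive in a separated configuration), from
`V_LJ(t) ≥ −t⁻⁶/6`. [folklore] -/
theorem cross_lennardJones_ge (w : Fin N → EuclideanSpace ℝ (Fin 3)) {δ : ℝ} (hδ : 0 < δ)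
    (hsep : ∀ k l, k ≠ l → δ ≤ dist (w k) (w l)) (B C : Finset (Fin N))
    (hCne : ∀ a ∈ B, ∀ b ∈ C, b ≠ a) :
    -((1 / 6) * ∑ a ∈ B, ∑ b ∈ C, (dist (w a) (w b))⁻¹ ^ 6) ≤
      ∑ a ∈ B, ∑ b ∈ C, lennardJones (dist (w a) (w b)) := by
  rw [Finset.mul_sum, ← Finset.sum_neg_distrib]
  refine Finset.sum_le_sum fun a ha => ?_
  rw [Finset.mul_sum, ← Finset.sum_neg_distrib]
  exact Finset.sum_le_sum fun b hb =>
    neg_le_lennardJones_of_le (hδ.trans_le (hsep a b (Ne.symm (hCne a ha b hb)))) le_rfl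

/-- **Ground-state energy below `(e_per + η)·n` for large `n`.**  From `E(n)/n → e_per = ⨅_Q e_LJ(Q)`
(`ChargedEnergyGapNegative.crysEnergyLimit`): for every `η > 0` there is `n₀` with `E(n) ≤ (e_per + η) n` for all
`n ≥ n₀`. [folklore] -/
theorem exists_groundStateEnergy_le (η : ℝ) (hη : 0 < η) :
    ∃ n₀ : ℕ, ∀ n : ℕ, n₀ ≤ n → groundStateEnergy lennardJones 3 n ≤
      ((⨅ Q : PeriodicConfiguration 3, Q.energyPerParticle lennardJones) + η) * n := by
  have hlim := ChargedEnergyGapNegative.crysEnergyLimit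
  have hev : ∀ᶠ n : ℕ in Filter.atTop, groundStateEnergy lennardJones 3 n / n <
      (⨅ Q : PeriodicConfiguration 3, Q.energyPerParticle lennardJones) + η :=
    hlim.eventually (Iio_mem_nhds (by linarith))
  obtain ⟨n₁, hn₁⟩ := Filter.eventually_atTop.1 hev
  refine ⟨max n₁ 1, fun n hn => ?_⟩
  have hn1 : 1 ≤ n := le_trans (le_max_right _ _) hn
  have hnpos : (0 : ℝ) < n := by exact_mod_cast hn1
  have h := hn₁ n (le_trans (le_max_left _ _) hn)
  rw [div_lt_iff₀ hnpos] at h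
  exact h.le

/-- Registered stub `stub_windowEnergyCeiling` (S4) of the crux `TexturedLawTransfer` (route FrustratedLawDichotomy,
stmt-AtomisticToContinuum-27625; skeleton line «truncated-bs»), with its registered signature: the window energy
ceiling `Σ_{B×B} V_LJ ≤ (e_per + η)·2#B` for thin-shelled large ball clusters of Lennard-Jones ground states.
[cite: BlancLewin2015, §1.2] -/
theorem stub_windowEnergyCeiling : ∀ η : ℝ, 0 < η → ∃ L : ℝ, 0 < L ∧ ∃ ε : ℝ, 0 < ε ∧ ∃ n₀ : ℕ, ∀ (N : ℕ) (w : Fin N → EuclideanSpace ℝ (Fin 3)), Literature.MathematicalPhysics.StatisticalMechanics.IsGroundState Literature.MathematicalPhysics.StatisticalMechanics.lennardJones w → ∀ (i : Fin N) (r : ℝ), n₀ ≤ ((Finset.univ.filter (fun j : Fin N => dist (w j) (w i) ≤ r))).card → (((Finset.univ.filter (fun j : Fin N => r - L < dist (w j) (w i) ∧ dist (w j) (w i) ≤ r))).card : ℝ) ≤ ε * (((Finset.univ.filter (fun j : Fin N => dist (w j) (w i) ≤ r))).card : ℝ) → (∑ j ∈ (Finset.univ.filter (fun j : Fin N => dist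 (w j) (w i) ≤ r)), ∑ k ∈ (Finset.univ.filter (fun j : Fin N => dist (w j) (w i) ≤ r)), Literature.MathematicalPhysics.StatisticalMechanics.lennardJones (dist (w k) (w j))) ≤ ((⨅ Q : Literature.MathematicalPhysics.StatisticalMechanics.PeriodicConfiguration 3, Q.energyPerParticle Literature.MathematicalPhysics.StatisticalMechanics.lennardJones) + η) * (2 * (((Finset.univ.filter (fun j : Fin N => dist (w j) (w i) ≤ r))).card : ℝ)) := by
  intro η hη
  obtain ⟨δ, hδ, hsepGS⟩ := LennardJonesMinimalDistance_holds
  obtain ⟨n₀, hn₀⟩ := exists_groundStateEnergy_le (η / 2) (half_pos hη)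
  have hc5 : 0 < 250 / 6 * δ⁻¹ ^ 5 := by positivity
  have hc6 : 0 < 250 / 6 * δ⁻¹ ^ 6 := by positivity
  refine ⟨max 1 (4 * (250 / 6 * δ⁻¹ ^ 5) / η), lt_of_lt_of_le one_pos (le_max_left _ _),
    η / (4 * (250 / 6 * δ⁻¹ ^ 6)), by positivity, n₀, ?_⟩
  intro N w hw i r hn hthin
  set L : ℝ := max 1 (4 * (250 / 6 * δ⁻¹ ^ 5) / η) with hLdef
  set ε : ℝ := η / (4 * (250 / 6 * δ⁻¹ ^ 6)) with hεdef
  set B := Finset.univ.filter (fun j : Fin N => dist (w j) (w i) ≤ r) with hBdef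
  set S := Finset.univ.filter (fun j : Fin N => r - L < dist (w j) (w i) ∧ dist (w j) (w i) ≤ r) with hSdef
  have hL0 : 0 < L := lt_of_lt_of_le one_pos (le_max_left _ _)
  have hsep : ∀ k l, k ≠ l → δ ≤ dist (w k) (w l) := hsepGS N w hw
  have hA : 250 / 6 * δ⁻¹ ^ 5 * L⁻¹ ≤ η / 4 := by
    have h1 : 4 * (250 / 6 * δ⁻¹ ^ 5) / η ≤ L := le_max_right _ _
    have h2 : L⁻¹ ≤ (4 * (250 / 6 * δ⁻¹ ^ 5) / η)⁻¹ := inv_anti₀ (by positivity) h1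
    calc 250 / 6 * δ⁻¹ ^ 5 * L⁻¹ ≤ 250 / 6 * δ⁻¹ ^ 5 * (4 * (250 / 6 * δ⁻¹ ^ 5) / η)⁻¹ :=
          mul_le_mul_of_nonneg_left h2 hc5.le
      _ = η / 4 := by
          field_simp
  have hBε : 250 / 6 * δ⁻¹ ^ 6 * ε = η / 4 := by
    rw [hεdef]
    field_simp
  have hcp := CrystalliteDichotomyCutPasteLaw.pairSum_add_two_mul_cross_le_groundStateEnergy hw B
  have hBmem : ∀ a ∈ B, dist (w a) (w i) ≤ r := fun a ha => (Finset.mem_filter.1 ha).2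
  have hCmem : ∀ b ∈ Bᶜ, r < dist (w b) (w i) := fun b hb =>
    not_le.1 fun h => Finset.mem_compl.1 hb (Finset.mem_filter.2 ⟨Finset.mem_univ b, h⟩)
  have hSmem : ∀ a ∈ B, r - L < dist (w a) (w i) → a ∈ S := fun a ha h =>
    Finset.mem_filter.2 ⟨Finset.mem_univ a, h, hBmem a ha⟩
  have hCne : ∀ a ∈ B, ∀ b ∈ Bᶜ, b ≠ a := fun a ha b hb hba =>
    Finset.mem_compl.1 hb (hba ▸ ha)
  have h6 := cross_inv_pow_six_le w hδ hsep i r L hL0 B Bᶜ S hBmem hCmem hSmem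
  have hV := cross_lennardJones_ge w hδ hsep B Bᶜ hCne
  have hg := hn₀ B.card hn
  have hn0 : (0 : ℝ) ≤ B.card := Nat.cast_nonneg _
  have hA' : 250 / 6 * δ⁻¹ ^ 5 * L⁻¹ * (B.card : ℝ) ≤ η / 4 * B.card :=
    mul_le_mul_of_nonneg_right hA hn0
  have hS' : 250 / 6 * δ⁻¹ ^ 6 * (S.card : ℝ) ≤ η / 4 * B.card := by
    have h := mul_le_mul_of_nonneg_left hthin hc6.le
    rwa [← mul_assoc, hBε] at h
  rw [Finset.sum_comm]
  linarith

end Summit.AtomisticToContinuum.Crystallization.Theorems.FrustratedLawDichotomyWindowEnergyCeiling
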